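import Summits.CriticalPhenomena.Ising3DConformalLimit.Theses.CoerciveSharpness
import Literature.Probability.LatticeModels.SharpLengthDCPProofs
import Literature.Probability.LatticeModels.SusceptibilityMeanFieldBound

/-!
# The box/superset split of the crux `CoerciveSharpness.PhiCoercive` (stmt-CriticalPhenomena-18196) — glue and proved structure (sorry-free)

Crux strategist `planner-cstrat-stmt-CriticalPhenomena-18196-b1-0` (before any lead), route
`CoerciveSharpness`, sub-problem `CriticalPhenomena/Ising3DConformalLimit`; companion card
`Cruxes/PhiCoercive/Lines/box-superset.md`, census `Cruxes/PhiCoercive/STRATEGY-CENSUS.md`.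

`PhiCoercive` says: the Duminil-Copin–Panis sharpness functional
`φ(S) = β_c Σ_{x ∈ S} #{y ∉ S : y ∼ x} ⟨σ₀σ_x⟩^free_{S,β_c}` (written out in the route file; it is
`dcpPhi 3 (criticalBeta 3) S`, `phiC_eq_dcpPhi` below, `rfl`) satisfies `φ(S) ≥ c m^κ` for SOME
`κ > 0`, EVERY `m ≥ 1` and EVERY finite `S ⊇ Λ_m`.  Two logically independent things are asserted:

* `BoxCoercive` — growth ON BOXES: `φ(Λ_m) ≥ c m^κ`.  This is the surface-critical-exponent
  statement `κ_box = d − 1 − Δ_σ − Δ̂_σ = 1 − η_⊥ > 0` on `ℤ³` (numerically `0.194 ± 0.002`,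
  refuter job j022942; `3/8` exactly on `ℤ²`; `0` in mean field).  OPEN-PROBLEM: it would be the
  first strictly non-mean-field critical exponent inequality proved for the nearest-neighbour
  Ising model on `ℤ³` (census §Transfer/§Strengthen).
* `SupersetStable` — SHAPE STABILITY: every finite `S ⊇ Λ_m` radiates at least a fixed fraction of
  what some box `Λ_r`, `r ≥ m`, radiates: `∃ c' > 0, ∀ m ≥ 1, ∀ S ⊇ Λ_m, ∃ r ≥ m, c' φ(Λ_r) ≤ φ(S)`.
  `φ` is NOT monotone in `S` (covering a face of `Λ_m` deletes its boundary edges), so this is a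
  genuine statement; GKS surgery controls one-site decorations, moats-with-bridges, hairs, combs
  (refuter notes on the item), but no printed tool covers porous coverings layer by layer.  It is
  the refutable half: an explicit family `S_m ⊇ Λ_m` with `φ(S_m) = O(1)` kills the crux as typed
  (the route then restates K1 on the random sets `𝒮_n` of DC–Panis §2.2 only).

Nothing is asserted here: the two pieces are `def … : Prop` statements (objects the route posits)
and every theorem is an unconditional implication / inequality.  To be landed verbatim by a PROVER as
`Theorems/CoerciveSharpnessPhiCoerciveSplit.lean --supports stmt-CriticalPhenomena-18196` (planner
role cannot write Theorems/), after which the tenure planner files `route edit --split PhiCoercive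
--into children.json --glue-by …PhiCoercive_of_subs` (`Cruxes/PhiCoercive/DECOMPOSITION.md`).
The composition `PhiCoercive_of : BoxCoercive → SupersetStable → PhiCoercive` is proved (real
arithmetic: `c' c m^κ ≤ c' c r^κ ≤ c' φ(Λ_r) ≤ φ(S)`).  Also proved here: `phiC_eq_dcpPhi` (the route text IS `dcpPhi`), `one_le_phiC` (the
`κ = 0` shadow of BOTH stubs is a theorem: `φ_{β_c}(S) ≥ 1` for every finite `S ∋ 0`, Duminil-Copin–
Tassion 2016 via the tree's `one_le_dctIsingPhi_of_criticalBeta_le` + `dctIsingPhi_le_dcpPhi`),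
`phiC_ge_inner` (EXPOSURE THROUGH HOLES: for `T ⊆ S`, `φ(S) ≥ β_c Σ_{x∈T} #{y ∉ S : y ∼ x} ⟨σ₀σ_x⟩_T`
— GKS volume monotonicity; the first inequality of any superset argument), and the two degenerate
instances `supersetStable_box` (S a box: r := M) and `boxCoercive_kappa_zero`.

Disproof.lean for this crux: none published yet (no `_false_without_` certificates to honour).
Negatives index: nothing on Ising3DConformalLimit.
-/

noncomputable section

namespace Summit.CriticalPhenomena.Ising3DConformalLimit.Cruxes.PhiCoercive.BoxSuperset

open scoped BigOperators
open Finset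
open Literature.Probability.LatticeModels
open Summit.CriticalPhenomena.Ising3DConformalLimit.Theses.CoerciveSharpness (PhiCoercive)

/-! ## Vocabulary: the route's written-out `φ_{β_c}(S)` -/

/-- `φ_{β_c}(S)` exactly as written in the route decl `PhiCoercive`:
`β_c(3) · Σ_{x ∈ S} #{y ∉ S : y ∼ x} · ⟨σ₀σ_x⟩^free_{S, β_c(3)}`. -/
def phiC (S : Finset (Site 3)) : ℝ :=
  criticalBeta 3 * ∑ x ∈ S, ((((zdGraph 3).neighborFinset x).filter fun y => y ∉ S).card : ℝ) *
    isingTwoPoint (zdGraph 3) S (criticalBeta 3) 0 .free 0 x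

/-- The route text is the tree's `dcpPhi` (Duminil-Copin–Panis 2025, Def. 1.1) at `β_c(3)`. -/
theorem phiC_eq_dcpPhi (S : Finset (Site 3)) : phiC S = dcpPhi 3 (criticalBeta 3) S := rfl

/-- The crux, unfolded over `phiC`. -/
theorem phiCoercive_iff :
    PhiCoercive ↔ ∃ κ c : ℝ, 0 < κ ∧ 0 < c ∧ ∀ m : ℕ, 1 ≤ m → ∀ S : Finset (Site 3),
      box 3 m ⊆ S → c * (m : ℝ) ^ κ ≤ phiC S :=
  Iff.rfl

/-! ## The two pieces -/

/-- **Piece 1 (crux, open-problem): coercivity ON BOXES.** `∃ κ c > 0, ∀ m ≥ 1, c·m^κ ≤ φ_{β_c}(Λ_m)`.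
Surface scaling predicts `κ = 1 − η_⊥ ≈ 0.21` on `ℤ³`; any proof must be interaction- and
dimension-sensitive (`κ = 0` exactly in mean field / `d ≥ 5`). -/
def BoxCoercive : Prop :=
  ∃ κ c : ℝ, 0 < κ ∧ 0 < c ∧ ∀ m : ℕ, 1 ≤ m → c * (m : ℝ) ^ κ ≤ phiC (box 3 m)

/-- **Piece 2 (crux, L / refutable): superset stability.** Every finite `S ⊇ Λ_m` radiates at least
a fixed fraction of what SOME box `Λ_r` with `r ≥ m` radiates:
`∃ c' > 0, ∀ m ≥ 1, ∀ S ⊇ Λ_m, ∃ r ≥ m, c'·φ_{β_c}(Λ_r) ≤ φ_{β_c}(S)`.  (The flexible `∃ r ≥ m`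
lets `S = Λ_M` compare with itself; with `BoxCoercive` any `r ≥ m` is as good as `m`.) -/
def SupersetStable : Prop :=
  ∃ c' : ℝ, 0 < c' ∧ ∀ m : ℕ, 1 ≤ m → ∀ S : Finset (Site 3), box 3 m ⊆ S →
    ∃ r : ℕ, m ≤ r ∧ c' * phiC (box 3 r) ≤ phiC S

/-! ## The composition (kernel-checked, no sorry) -/

/-- **`BoxCoercive → SupersetStable → PhiCoercive`**: `c' c m^κ ≤ c' c r^κ ≤ c' φ(Λ_r) ≤ φ(S)`. -/
theorem PhiCoercive_of : BoxCoercive → SupersetStable → PhiCoercive := by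
  rintro ⟨κ, c, hκ, hc, hbox⟩ ⟨c', hc', hsup⟩
  refine ⟨κ, c' * c, hκ, mul_pos hc' hc, fun m hm S hS => ?_⟩
  obtain ⟨r, hmr, hr⟩ := hsup m hm S hS
  have hbr : c * (r : ℝ) ^ κ ≤ phiC (box 3 r) := hbox r (le_trans hm hmr)
  have hmono : (m : ℝ) ^ κ ≤ (r : ℝ) ^ κ :=
    Real.rpow_le_rpow (by positivity) (by exact_mod_cast hmr) hκ.le
  show c' * c * (m : ℝ) ^ κ ≤ phiC S
  calc c' * c * (m : ℝ) ^ κ = c' * (c * (m : ℝ) ^ κ) := by ring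
    _ ≤ c' * (c * (r : ℝ) ^ κ) :=
        mul_le_mul_of_nonneg_left (mul_le_mul_of_nonneg_left hmono hc.le) hc'.le
    _ ≤ c' * phiC (box 3 r) := mul_le_mul_of_nonneg_left hbr hc'.le
    _ ≤ phiC S := hr

/-- Same composition, named as the split glue `PhiCoercive_of_subs` (for `route edit --split PhiCoercive
--into BoxCoercive SupersetStable --glue-by …`). -/
theorem PhiCoercive_of_subs : BoxCoercive → SupersetStable → PhiCoercive := PhiCoercive_of

/-! ## Proved structure for the attack on the stubs -/

/-- **The `κ = 0` shadow is a theorem**: `1 ≤ φ_{β_c}(S)` for every finite `S ∋ 0`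
(Duminil-Copin–Tassion 2016, Prop. for Ising; tree: `one_le_dctIsingPhi_of_criticalBeta_le` with
`dctIsingPhi ≤ dcpPhi`).  So in both pieces only GROWTH / the constant is at stake. -/
theorem one_le_phiC {S : Finset (Site 3)} (h0 : (0 : Site 3) ∈ S) : 1 ≤ phiC S := by
  have hgks : ∀ {Λ A : Finset (Site 3)} {β h : ℝ} {bc : BoundaryCondition (Site 3)},
      gks_one (zdGraph 3) (Λ := Λ) (A := A) (β := β) (h := h) (bc := bc) :=
    GKSInequalities.gks_one_holds (zdGraph 3)
  rw [phiC_eq_dcpPhi]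
  exact (one_le_dctIsingPhi_of_criticalBeta_le (d := 3) (by norm_num) le_rfl S h0).trans
    (dctIsingPhi_le_dcpPhi hgks (criticalBeta_nonneg 3) h0)

/-- `0 ∈ Λ_m ⊆ S` gives `0 ∈ S`. -/
theorem zero_mem_of_box_subset {m : ℕ} {S : Finset (Site 3)} (hS : box 3 m ⊆ S) : (0 : Site 3) ∈ S :=
  hS (zero_mem_box 3 m)

/-- **Exposure through holes (GKS).** For `0 ∈ T ⊆ S` finite:
`φ_{β_c}(S) ≥ β_c Σ_{x ∈ T} #{y ∉ S : y ∼ x} · ⟨σ₀σ_x⟩^free_T` — the boundary edges of `S` that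
start in the inner set `T` already carry at least the flux computed with `T`'s own (smaller, GKS)
correlations.  With `T = Λ_k ∩ S`-type inner sets this is the first line of every superset argument. -/
theorem phiC_ge_inner {T S : Finset (Site 3)} (hTS : T ⊆ S) (h0 : (0 : Site 3) ∈ T) :
    criticalBeta 3 * ∑ x ∈ T, ((((zdGraph 3).neighborFinset x).filter fun y => y ∉ S).card : ℝ) *
        isingTwoPoint (zdGraph 3) T (criticalBeta 3) 0 .free 0 x ≤ phiC S := by
  have hβ : 0 ≤ criticalBeta 3 := criticalBeta_nonneg 3
  have hgks2 : ∀ (G' : SimpleGraph (Site 3)) [G'.LocallyFinite] (Λ A B : Finset (Site 3))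
      (β h : ℝ) (bc : BoundaryCondition (Site 3)),
      gks_two G' (Λ := Λ) (A := A) (B := B) (β := β) (h := h) (bc := bc) :=
    fun G' _ _ _ _ _ _ _ => GKSInequalities.gks_two_holds G'
  have hgks : ∀ {Λ A : Finset (Site 3)} {β h : ℝ} {bc : BoundaryCondition (Site 3)},
      gks_one (zdGraph 3) (Λ := Λ) (A := A) (β := β) (h := h) (bc := bc) :=
    GKSInequalities.gks_one_holds (zdGraph 3)
  have hmono : isingCorr_free_mono_volume (d := 3) := isingCorr_free_mono_volume_of_gks_two hgks2
  unfold phiC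
  refine mul_le_mul_of_nonneg_left ?_ hβ
  calc ∑ x ∈ T, ((((zdGraph 3).neighborFinset x).filter fun y => y ∉ S).card : ℝ) *
          isingTwoPoint (zdGraph 3) T (criticalBeta 3) 0 .free 0 x
        ≤ ∑ x ∈ T, ((((zdGraph 3).neighborFinset x).filter fun y => y ∉ S).card : ℝ) *
          isingTwoPoint (zdGraph 3) S (criticalBeta 3) 0 .free 0 x := by
        refine Finset.sum_le_sum fun x hx => ?_
        exact mul_le_mul_of_nonneg_left
          (isingTwoPoint_free_mono_volume hmono hβ hTS h0 hx) (by positivity)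
    _ ≤ ∑ x ∈ S, ((((zdGraph 3).neighborFinset x).filter fun y => y ∉ S).card : ℝ) *
          isingTwoPoint (zdGraph 3) S (criticalBeta 3) 0 .free 0 x := by
        refine Finset.sum_le_sum_of_subset_of_nonneg hTS fun x hxS _ => ?_
        exact mul_nonneg (by positivity)
          (isingTwoPoint_free_nonneg hgks hβ (hTS h0) hxS)

/-- Degenerate instance of `SupersetStable`: a box `S = Λ_M ⊇ Λ_m` compares with itself (`r := M`,
any `c' ≤ 1`). -/
theorem supersetStable_box {m M : ℕ} (hmM : m ≤ M) :
    ∃ r : ℕ, m ≤ r ∧ 1 * phiC (box 3 r) ≤ phiC (box 3 M) :=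
  ⟨M, hmM, by rw [one_mul]⟩

/-- The `κ = 0` shadow of `BoxCoercive` is a theorem (`c = 1`). -/
theorem boxCoercive_kappa_zero : ∀ m : ℕ, 1 ≤ m → (1 : ℝ) * (m : ℝ) ^ (0 : ℝ) ≤ phiC (box 3 m) := by
  intro m _
  rw [Real.rpow_zero, one_mul]
  exact one_le_phiC (zero_mem_box 3 m)

end Summit.CriticalPhenomena.Ising3DConformalLimit.Cruxes.PhiCoercive.BoxSuperset

end
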